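import Summits.QuantumFields.BalabanUV.Beta.D1BFx.TorusBondArrays
import Summits.QuantumFields.BalabanUV.Beta.D1BFx.TorusGhostPairStencils

/-!
# TB4-W PART 3b-N (FILE N3a) — TWO-ARRAY WORDS: s-dependent `ℤ⁴` families, their torus letters, uniform localisation and limits
# (road «BF-x», slot (K); ruling ρ-g7-8, shape (S1))

Ruling ρ-g7-8 (journal l.26338): the mixed straight weight jet `2•wgtMix b b′` (3a) contains TWO-array monomials with a NON-LOCAL leg between the
bond-localised factors; they periodise to arrays of s-DEPENDENT `ℤ⁴` families `X ∘ A ∘ arr s Y`, and the statement of record (S1) is the EXACT per-torus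
identity with such families plus (u1) localisation UNIFORM in `s` and (u2) ENTRYWISE limits.  This file supplies the generic letters:
* §1 **uniform localisation** (re-centring to the pair's points is `KernelWard.biLoc_recentre`, by name) of `K ∘ arr s Y` and `arr s Y ∘ K` at `K`'s own points
  (`decays_arr`: the array of a bi-localised kernel is an s-UNIFORMLY decaying leg);
* §2 the torus letter **`perT (arr X) · perT A · perT (arr Y) = perT (arr (X ∘ A ∘ arr s Y))`** (every `s`; B1∕B2 product rules);
* §3 the TWO-`Ê` word: [our object] `eYe s κ u l u′ Y` (single bond entry carrying the PERIODISED scalar `Ŷ(σt_b, σt_b′)`), the exact letter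
  **`Ê_b · perT Y · Ê_b′ᵀ = (arr s (eYe s κ u l u′ Y))^`**, its s-uniform localisation and its limit (an4's `tendsto_periodise₂'`);
* §4 ENTRYWISE LIMITS along `σ k → ∞`: `arr (σ k) Y → Y`, `K ∘ arr (σ k) Y → K ∘ Y`, `arr (σ k) Y ∘ K → Y ∘ K` (dominated convergence).
[folklore] throughout; the one definition `eYe` asserts nothing.
-/

noncomputable section

namespace Summit.QuantumFields.BalabanUV.Beta.D1BFx.TorusTwoArrayWords

open Matrix Filter Topology
open scoped BigOperators
open Literature.MathematicalPhysics.QuantumFieldTheory.Balaban1983to89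
open Literature.MathematicalPhysics.QuantumFieldTheory.Balaban1983to89.Beta
open B12Sec2to5 (l1 l1_nonneg)
open ExpKernelCalculus (MKer BiLoc Decays Zl comp biLoc_comp_decays summable_exp_shift')
open AffineAveraging (unitVec)
open KernelWard (Bdd)
open BalabanStepJetsSucc (biLoc_comp_right)
open Summit.QuantumFields.BalabanUV.Beta.TameKernelCalculus (decays_of_le biLoc_of_le)
open Summit.QuantumFields.BalabanUV.Beta.D1BFx.PeriodicArrays (arr arr_apply toF toF_apply Kfib_toF periodise₂_arr decays_arr bdd_arr tendsto_arr)
open Summit.QuantumFields.BalabanUV.Beta.D1BFx.FibredPeriodisation (Kfib periodiseF periodiseF_apply)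
open Summit.QuantumFields.BalabanUV.Beta.D1BFx.TorusCoframeJets (tip Djet Djet_apply)
open Summit.QuantumFields.BalabanUV.Beta.D1BFx.TorusJetArrays (tip_siteOf tsum_tsum_ind_and)
open Summit.QuantumFields.BalabanUV.Beta.D1BFx.TorusGhostWordArrays (perT perT_apply perT_mul_perT_arr perT_arr_mul_perT)
open Summit.QuantumFields.BalabanUV.Beta.D1BFx.TorusGhostPairStencils (perT_arr_mul_perT_arr)

variable (s : ℕ) [NeZero s]

/-! ## §1 Uniform localisation of `K ∘ arr s Y` -/

section Loc

variable {F : Type*} [Fintype F] {K Y : MKer 4 F} {p q p' q' : Fin 4 → ℤ} {C CY δ : ℝ}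

/-- [folklore] **UNIFORM LOCALISATION OF `K ∘ arr s Y`** at `K`'s own points: the array of a bi-localised `Y` is an s-UNIFORMLY decaying leg
(`PeriodicArrays.decays_arr`), so `BiLoc (K ∘ arr s Y) p q C′ (δ/4)` with `C′` free of `s` (rate `δ` common to `K` and `Y`). -/
theorem biLoc_comp_arr (hK : BiLoc K p q C δ) (hY : BiLoc Y p' q' CY δ) (hδ : 0 < δ) :
    BiLoc (comp K (arr s Y)) p q
      ((Fintype.card F : ℝ) * (C * (CY * Zl 4 (δ / 2) * Real.exp (δ / 2 * l1 (p' - q')))) * Zl 4 (δ / 2 - δ / 4)) (δ / 4) :=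
  biLoc_comp_right (StepJetData.biLoc_weaken hK le_rfl (by linarith)) (decays_arr hY hδ s) (by linarith) (by linarith)

/-- [folklore] **UNIFORM LOCALISATION OF `arr s Y ∘ K`** at `K`'s points. -/
theorem biLoc_arr_comp (hY : BiLoc Y p' q' CY δ) (hK : BiLoc K p q C δ) (hδ : 0 < δ) :
    BiLoc (comp (arr s Y) K) p q
      ((Fintype.card F : ℝ) * (|CY * Zl 4 (δ / 2) * Real.exp (δ / 2 * l1 (p' - q'))| * C) * Zl 4 (δ / 2 - δ / 4)) (δ / 4) :=
  biLoc_comp_decays (decays_of_le (decays_arr hY hδ s) le_rfl) (StepJetData.biLoc_weaken hK le_rfl (by linarith)) (by linarith) (by linarith)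

end Loc

/-! ## §2 The torus letter of a two-array word -/

section Product

variable {X Y A : MKer 4 Unit} {p q p' q' : Fin 4 → ℤ} {CX CY CA δ : ℝ}

/-- [folklore] **`perT (arr X) · perT A · perT (arr Y) = perT (arr (X ∘ A ∘ arr s Y))`** for bi-localised `X`, `Y` and a decaying jointly
`s`-periodic leg `A` (common rate `δ`): the inner `arr s Y` is what makes the family s-dependent. -/
theorem perT_arr_leg_arr (hX : BiLoc X p p CX δ) (hA : Decays A CA δ)
    (hAper : ∀ x y t, ∀ a b : Unit, A (imageShift s x t) (imageShift s y t) a b = A x y a b) (hY : BiLoc Y p' p' CY δ) (hδ : 0 < δ) :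
    perT s (arr s X) * perT s A * perT s (arr s Y) = perT s (arr s (comp (comp X A) (arr s Y))) := by
  rw [perT_arr_mul_perT s hA hδ hAper hX hδ,
    perT_arr_mul_perT_arr s (biLoc_comp_right hX hA (half_pos hδ).le (half_lt_self hδ)) (half_pos hδ) hY hδ]

end Product

/-! ## §3 The two-`Ê` word -/

section TwoE

variable (κ : Fin 4) (u : Fin 4 → ℤ) (l : Fin 4) (u' : Fin 4 → ℤ) (Y : MKer 4 Unit)

/-- [our object] **THE TWO-`Ê` TABLE**: the single bond entry `((u,κ),(u′,l))` carrying the PERIODISED scalar `Ŷ(σ(u+e_κ), σ(u′+e_l))`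
(an s-dependent number; its `s → ∞` limit is `Y (u+e_κ) (u′+e_l)`). A definition; asserts nothing. -/
def eYe : MKer 4 (Fin 4) := fun x z α β =>
  if x = u ∧ z = u' then
    (if α = κ ∧ β = l then periodise₂ s (Kfib (toF Y) () ()) (siteOf 4 s (u + unitVec κ)) (siteOf 4 s (u' + unitVec l)) else 0)
  else 0

/-- [our object] Unfolding `eYe`. -/
theorem eYe_apply (x z : Fin 4 → ℤ) (α β : Fin 4) : eYe s κ u l u' Y x z α β
    = if x = u ∧ z = u' then
        (if α = κ ∧ β = l then periodise₂ s (Kfib (toF Y) () ()) (siteOf 4 s (u + unitVec κ)) (siteOf 4 s (u' + unitVec l)) else 0)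
      else 0 := rfl

/-- [folklore] `eYe` is supported at the single point pair `(u, u′)`: `BiLoc (eYe …) u u′ |v| δ` for every real `δ`, `v` the carried scalar. -/
theorem biLoc_eYe (δ : ℝ) : BiLoc (eYe s κ u l u' Y) u u'
    (|periodise₂ s (Kfib (toF Y) () ()) (siteOf 4 s (u + unitVec κ)) (siteOf 4 s (u' + unitVec l))|) δ := by
  intro x z α β
  rw [eYe_apply]
  by_cases h : x = u ∧ z = u'
  · rw [if_pos h, h.1, h.2, sub_self, sub_self, GhostStencil.l1_zero, add_zero, mul_zero, Real.exp_zero, mul_one]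
    split_ifs
    · exact le_rfl
    · rw [abs_zero]; exact abs_nonneg _
  · rw [if_neg h, abs_zero]; positivity

/-- [folklore] **UNIFORM BOUND of the carried scalar**: `|Ŷ(σt, σt′)| ≤ B` for a leg with uniform row bound `B` (an4 `abs_periodise₂_le`), so
`BiLoc (eYe s …) u u′ B δ` with `B` free of `s`. -/
theorem biLoc_eYe_of_rowBound {B : ℝ} (hB : RowBound (Kfib (toF Y) () ()) B) (δ : ℝ) : BiLoc (eYe s κ u l u' Y) u u' B δ :=
  StepJetData.biLoc_weaken (biLoc_eYe s κ u l u' Y δ) (abs_periodise₂_le hB _ _) le_rfl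

/-- [folklore] `(Ê_b · M)(i, z′) = [i = b]·M(tip b, z′)`. -/
theorem Djet_mul_apply (M : Matrix (Site 4 s) (Site 4 s) ℝ) (i : Site 4 s × Fin 4) (z' : Site 4 s) :
    (Djet s (siteOf 4 s u, κ) * M) i z' = if i = (siteOf 4 s u, κ) then M (siteOf 4 s (u + unitVec κ)) z' else 0 := by
  rw [Matrix.mul_apply]
  by_cases hi : i = (siteOf 4 s u, κ)
  · simp only [Djet_apply, hi, true_and, boole_mul, tip_siteOf, Finset.sum_ite_eq', Finset.mem_univ, if_true]
  · simp only [Djet_apply, hi, false_and, if_false, zero_mul, Finset.sum_const_zero]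

/-- [folklore] `(M · Ê_b′ᵀ)(i, j) = [j = b′]·M(i, tip b′)`. -/
theorem mul_Djet_transpose_apply {ι : Type*} (M : Matrix ι (Site 4 s) ℝ) (i : ι) (j : Site 4 s × Fin 4) :
    (M * (Djet s (siteOf 4 s u', l))ᵀ) i j = if j = (siteOf 4 s u', l) then M i (siteOf 4 s (u' + unitVec l)) else 0 := by
  rw [Matrix.mul_apply]
  by_cases hj : j = (siteOf 4 s u', l)
  · simp only [Matrix.transpose_apply, Djet_apply, hj, true_and, mul_boole, tip_siteOf, Finset.sum_ite_eq', Finset.mem_univ, if_true]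
  · simp only [Matrix.transpose_apply, Djet_apply, hj, false_and, if_false, mul_zero, Finset.sum_const_zero]

/-- [folklore] **THE TWO-`Ê` LETTER**: `Ê_b · perT Y · Ê_b′ᵀ = (arr s (eYe s κ u l u′ Y))^` at `b = (σu, κ)`, `b′ = (σu′, l)`, every `s` and every site kernel `Y`
(both sides are the single bond entry `(b, b′)` with the value `(perT Y)(tip b, tip b′)`). -/
theorem Djet_mul_perT_mul_Djet_transpose :
    Djet s (siteOf 4 s u, κ) * perT s Y * (Djet s (siteOf 4 s u', l))ᵀ = Matrix.of (periodiseF s (toF (arr s (eYe s κ u l u' Y)))) := by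
  ext ⟨x, α⟩ ⟨z, β⟩
  rw [mul_Djet_transpose_apply, Djet_mul_apply, Matrix.of_apply, periodiseF_apply, periodise₂_arr (biLoc_eYe s κ u l u' Y 1) one_pos]
  simp only [eYe_apply]
  rw [tsum_tsum_ind_and s x z u u' _, perT_apply, periodiseF_apply]
  by_cases hx : x = siteOf 4 s u <;> by_cases hz : z = siteOf 4 s u' <;> by_cases hα : α = κ <;> by_cases hβ : β = l <;>
    simp [hx, hz, hα, hβ]

variable {Y} {C δ : ℝ} {σ : ℕ → ℕ} [∀ k, NeZero (σ k)]

/-- [folklore] **THE LIMIT OF THE CARRIED SCALAR** (an4 `tendsto_periodise₂'`): along `σ k → ∞` with `Y` jointly `σ k`-periodic and decaying,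
`Ŷ_{σk}(σt, σt′) → Y t t′`. -/
theorem tendsto_eYe_val (hY : Decays Y C δ) (hδ : 0 < δ) (hper : ∀ k, IsPeriodic₂ (σ k) (Kfib (toF Y) () ())) (hσ : Tendsto σ atTop atTop)
    (t t' : Fin 4 → ℤ) :
    Tendsto (fun k => periodise₂ (σ k) (Kfib (toF Y) () ()) (siteOf 4 (σ k) t) (siteOf 4 (σ k) t')) atTop (𝓝 (Y t t' () ())) :=
  tendsto_periodise₂' hper (fun x y => hY x y () ()) hδ hσ t t'

/-- [folklore] **ENTRYWISE LIMIT OF THE TWO-`Ê` TABLE**: `eYe (σ k) κ u l u′ Y → [x = u ∧ z = u′][α = κ ∧ β = l]·Y (u+e_κ) (u′+e_l)` entrywise. -/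
theorem tendsto_eYe (hY : Decays Y C δ) (hδ : 0 < δ) (hper : ∀ k, IsPeriodic₂ (σ k) (Kfib (toF Y) () ())) (hσ : Tendsto σ atTop atTop)
    (x z : Fin 4 → ℤ) (α β : Fin 4) :
    Tendsto (fun k => eYe (σ k) κ u l u' Y x z α β) atTop
      (𝓝 (if x = u ∧ z = u' then (if α = κ ∧ β = l then Y (u + unitVec κ) (u' + unitVec l) () () else 0) else 0)) := by
  simp only [eYe_apply]
  split_ifs
  · exact tendsto_eYe_val hY hδ hper hσ _ _
  · exact tendsto_const_nhds
  · exact tendsto_const_nhds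

end TwoE

/-! ## §4 Entrywise limits of arrays inside words -/

section Limits

variable {F : Type*} [Fintype F] {K Y : MKer 4 F} {p q p' q' : Fin 4 → ℤ} {C CY δ : ℝ} {σ : ℕ → ℕ} [∀ k, NeZero (σ k)]

/-- [folklore] **`K ∘ arr (σ k) Y → K ∘ Y` ENTRYWISE** (dominated convergence over the middle point: `K`'s row decays, the arrays are
s-uniformly bounded by `bdd_arr`). -/
theorem tendsto_comp_arr_apply (hK : BiLoc K p q C δ) (hY : BiLoc Y p' q' CY δ) (hδ : 0 < δ) (hσ : Tendsto σ atTop atTop)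
    (x z : Fin 4 → ℤ) (a b : F) :
    Tendsto (fun k => comp K (arr (σ k) Y) x z a b) atTop (𝓝 (comp K Y x z a b)) := by
  have hC : 0 ≤ C := hK.nonneg a
  unfold ExpKernelCalculus.comp
  refine tendsto_tsum_of_dominated_convergence
    (bound := fun y => (Fintype.card F : ℝ) * (C * Real.exp (-δ * (l1 (x - p) + l1 (y - q)))
      * (CY * Zl 4 (δ / 2) * Real.exp (δ / 2 * l1 (p' - q'))))) ?_ ?_ ?_
  · have hs := (summable_exp_shift' (D := 4) hδ q).mul_left
      ((Fintype.card F : ℝ) * (C * Real.exp (-δ * l1 (x - p))) * (CY * Zl 4 (δ / 2) * Real.exp (δ / 2 * l1 (p' - q'))))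
    refine hs.congr fun y => ?_
    rw [mul_add, Real.exp_add]; ring
  · intro y
    exact tendsto_finsetSum _ fun f _ => ((tendsto_arr hY hδ y z f b).comp hσ).const_mul _
  · refine Eventually.of_forall fun k y => ?_
    calc ‖∑ f, K x y a f * arr (σ k) Y y z f b‖ ≤ ∑ f, ‖K x y a f * arr (σ k) Y y z f b‖ := norm_sum_le _ _
      _ ≤ ∑ _f : F, C * Real.exp (-δ * (l1 (x - p) + l1 (y - q))) * (CY * Zl 4 (δ / 2) * Real.exp (δ / 2 * l1 (p' - q'))) :=
          Finset.sum_le_sum fun f _ => by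
            rw [Real.norm_eq_abs, abs_mul]
            exact mul_le_mul (hK x y a f) (bdd_arr hY hδ (σ k) y z f b) (abs_nonneg _) (by positivity)
      _ = _ := by rw [Finset.sum_const, Finset.card_univ, nsmul_eq_mul]

/-- [folklore] **`arr (σ k) Y ∘ K → Y ∘ K` ENTRYWISE**. -/
theorem tendsto_arr_comp_apply (hY : BiLoc Y p' q' CY δ) (hK : BiLoc K p q C δ) (hδ : 0 < δ) (hσ : Tendsto σ atTop atTop)
    (x z : Fin 4 → ℤ) (a b : F) :
    Tendsto (fun k => comp (arr (σ k) Y) K x z a b) atTop (𝓝 (comp Y K x z a b)) := by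
  have hC : 0 ≤ C := hK.nonneg a
  unfold ExpKernelCalculus.comp
  refine tendsto_tsum_of_dominated_convergence
    (bound := fun y => (Fintype.card F : ℝ) * ((CY * Zl 4 (δ / 2) * Real.exp (δ / 2 * l1 (p' - q')))
      * (C * Real.exp (-δ * (l1 (y - p) + l1 (z - q)))))) ?_ ?_ ?_
  · have hs := (summable_exp_shift' (D := 4) hδ p).mul_left
      ((Fintype.card F : ℝ) * (CY * Zl 4 (δ / 2) * Real.exp (δ / 2 * l1 (p' - q'))) * (C * Real.exp (-δ * l1 (z - q))))
    refine hs.congr fun y => ?_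
    rw [mul_add, Real.exp_add]; ring
  · intro y
    exact tendsto_finsetSum _ fun f _ => ((tendsto_arr hY hδ x y a f).comp hσ).mul_const _
  · refine Eventually.of_forall fun k y => ?_
    calc ‖∑ f, arr (σ k) Y x y a f * K y z f b‖ ≤ ∑ f, ‖arr (σ k) Y x y a f * K y z f b‖ := norm_sum_le _ _
      _ ≤ ∑ _f : F, (CY * Zl 4 (δ / 2) * Real.exp (δ / 2 * l1 (p' - q'))) * (C * Real.exp (-δ * (l1 (y - p) + l1 (z - q)))) :=
          Finset.sum_le_sum fun f _ => by
            rw [Real.norm_eq_abs, abs_mul]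
            exact mul_le_mul (bdd_arr hY hδ (σ k) x y a f) (hK y z f b) (abs_nonneg _)
              (mul_nonneg (mul_nonneg (hY.nonneg a) (ExpKernelCalculus.Zl_pos (half_pos hδ)).le) (Real.exp_pos _).le)
      _ = _ := by rw [Finset.sum_const, Finset.card_univ, nsmul_eq_mul]

end Limits



end Summit.QuantumFields.BalabanUV.Beta.D1BFx.TorusTwoArrayWords

end
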